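import Summits.QuantumFields.GaugeBoot.TiltedSiteRPAnyBeta
import HarnessLib

/-!
# The frame's half-space classes on the cubic torus ARE Wave 0's observable classes
# (gauge-boot, L3 structural supplement: the bridge to `ConstructiveQFTWave0`)

HONEST FRAMING (cell `pub-gaugeboot`, page 1 of every file): the venture produces certified bounds
on lattice expectations at stated coupling, gauge group, dimension and torus size; NOT a mass gap,
NOT a continuum limit, NOT a string tension; NOT Yang–Mills-summit-bearing (barriers
`FixedCouplingUltralocality`, `PerturbativeInvisibility`). This module bounds no expectation.

The tree holds two formalisations of Osterwalder–Seiler reflection positivity on the even torus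
`(ℤ/L)^d`:

* Wave 0 (`Literature…ConstructiveQFTWave0*`): axis `0` only, every even `L ≥ 2`; site reflection
  `Θ' = GaugeConfig.negReflect` with observables `DependsOn F (sitePosEdges ∪ sharedEdges)` and ANY
  real `β` (`wilsonExpectation_siteReflectionPositive`); link reflection `Θ = GaugeConfig.timeReflect`
  with observables `IsPositiveTimeObservable F` and `β ≥ 0` (`wilsonExpectation_reflectionPositive_holds`);
* the lane's frame mechanism (`TiltedSiteRPPositivity`, `TiltedLinkRPPositivity`, instantiated on
  `Site d (2Q)` along every axis by `CubicTorusFrames` / `CubicTorusRP` / `TiltedSiteRPAnyBeta`):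
  observables `IsHalfObservable (cubicUnit d (2Q)) Q (cubicAxisCoord d (2Q) k)` (closed half
  `{0 ≤ x_k ≤ Q}`), resp. `IsMidObservable …` (`{1 ≤ x_k ≤ Q}`), `L = 2Q ≥ 4`.

Gen 55 identified the reflections on axis `0` (`configReflect_cubicUnit_zero = negReflect`,
`configMidReflect_cubicUnit_zero = timeReflect`). This module identifies the OBSERVABLE CLASSES on
axis `0`, so that on their common domain (`L = 2Q ≥ 4`, axis `0`, `G : Type`) the two families of
theorems are literally inter-derivable:

* `add_cubicUnit_eq_shift`: the lane's endpoint `x + e_m` is Wave 0's `x.shift m`;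
* `isHalfLink_cubicUnit_zero_iff` / `_iff_mem`: a link lies in the frame's closed half
  `{0 ≤ x_0 ≤ Q}` iff it is one of Wave 0's `sitePosEdges ∪ sharedEdges` (`Q ≥ 2`; at `Q = 1` the
  classes differ by the wrapping temporal link, and the frame does not exist);
* **`isHalfObservable_cubicUnit_zero_iff`**: `IsHalfObservable … 0 … F ↔ DependsOn F ↑(sitePosEdges ∪ sharedEdges)`;
* `isMidPosLink_cubicUnit_zero_iff` (`↔ WilsonRP.IsPosEdge`), `_iff_mem` (`↔ ∈ WilsonRP.posEdges`),
  **`isMidObservable_cubicUnit_zero_iff`**: `IsMidObservable … 0 … F ↔ IsPositiveTimeObservable F`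
  (every `Q`);
* `wilsonExpectation_siteRP_of_frame` (every real `β`) and `wilsonExpectation_linkRP_of_frame`
  (`β ≥ 0`): Wave 0's two axis-`0` statements, for `L = 2Q ≥ 4`, DERIVED from the frame mechanism;
* `cubicTorus_siteRP_negReflect_of_wave0`, `cubicTorus_linkRP_timeReflect_of_wave0`: conversely the
  frame's axis-`0` statements derived from Wave 0's theorems (these hold for `G : Type*`).

So the lane's site/link families (every axis, frame classes) restrict on axis `0` to exactly the
tree's Wave 0 theorems, with the same hypotheses (site: any real `β`, by `TiltedSiteRPAnyBeta`;
link: `β ≥ 0`) — a consistency certificate between the two formalisations, nothing more. Wave 0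
keeps the cases the frame theory does not cover (`L = 2`; the odd torus
`wilsonExpectation_oddReflectionPositive`).

References: K. Osterwalder, E. Seiler, Ann. Phys. 110 (1978) 440, §2; E. Seiler, LNP 159 (1982)
Ch. 2; J. Fröhlich, R. Israel, E. H. Lieb, B. Simon, Comm. Math. Phys. 62 (1978) 1, Thm. 2.1;
I. Montvay, G. Münster, Quantum Fields on a Lattice (1994) pp. 180–185.
-/

noncomputable section

open MeasureTheory Complex
open scoped ComplexOrder ComplexConjugate
open Literature.MathematicalPhysics.QuantumFieldTheory (Site Edge GaugeConfig wilsonMeasure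
  wilsonExpectation IsPositiveTimeObservable wilsonExpectation_siteReflectionPositive
  wilsonExpectation_reflectionPositive_holds)
open Literature.MathematicalPhysics.QuantumFieldTheory.WilsonSiteRP (IsSitePosEdge IsSharedEdge
  sitePosEdges sharedEdges mem_sitePosEdges mem_sharedEdges)
open Literature.MathematicalPhysics.QuantumFieldTheory.WilsonRP (IsPosEdge posEdges mem_posEdges)

namespace Summit.QuantumFields.GaugeBoot

namespace TiltedRP

/-! ## Endpoints -/

section Endpoints

variable {d L : ℕ}

/-- The lane's endpoint `x + e_m` of the link `(x, m)` of the cubic torus is Wave 0's `x.shift m`. -/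
theorem add_cubicUnit_eq_shift (x : Site d L) (m : Fin d) : x + cubicUnit d L m = x.shift m := rfl

end Endpoints

/-! ## The site family on axis `0`: closed half `{0 ≤ x_0 ≤ Q}` = `sitePosEdges ∪ sharedEdges` -/

section SiteClasses

variable {d Q : ℕ} [NeZero d]

/-- **A link of `(ℤ/2Q)^d` lies in the frame's closed half `{0 ≤ x_0 ≤ Q}` (both endpoints) iff it is
one of Wave 0's positive or shared links** (`Q ≥ 2`): temporal links `t → t + 1` with `t < Q`,
spatial links at heights `0 ≤ t ≤ Q`. -/
theorem isHalfLink_cubicUnit_zero_iff (hQ : 2 ≤ Q) (l : Edge d (2 * Q)) :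
    IsHalfLink (cubicUnit d (2 * Q)) Q (cubicAxisCoord d (2 * Q) 0) l ↔
      (IsSitePosEdge l ∨ IsSharedEdge l) := by
  obtain ⟨x, m⟩ := l
  haveI := neZero_two_mul hQ
  have hx : (x 0).val < 2 * Q := ZMod.val_lt _
  have hdiv : 2 * Q / 2 = Q := by omega
  have hend : ((x + cubicUnit d (2 * Q) m) 0).val =
      if m = 0 then (if (x 0).val + 1 = 2 * Q then 0 else (x 0).val + 1) else (x 0).val := by
    rw [Pi.add_apply, cubicUnit_apply]
    by_cases hm : m = 0
    · subst hm
      simp only [↓reduceIte]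
      exact val_add_one hQ _
    · simp only [hm, Ne.symm hm, ↓reduceIte, add_zero]
  simp only [IsHalfLink, InHalf, IsSitePosEdge, IsSharedEdge, cubicAxisCoord_apply, hend, hdiv]
  by_cases hm : m = 0
  · simp only [hm, ↓reduceIte, ne_eq, not_true_eq_false, false_and, or_false]
    split_ifs <;> omega
  · simp only [hm, ↓reduceIte, ne_eq, not_false_eq_true, true_and]
    omega

/-- The same, as membership in Wave 0's finset `sitePosEdges ∪ sharedEdges`. -/
theorem isHalfLink_cubicUnit_zero_iff_mem [NeZero Q] (hQ : 2 ≤ Q) (l : Edge d (2 * Q)) :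
    IsHalfLink (cubicUnit d (2 * Q)) Q (cubicAxisCoord d (2 * Q) 0) l ↔
      l ∈ (sitePosEdges ∪ sharedEdges : Finset (Edge d (2 * Q))) := by
  rw [Finset.mem_union, mem_sitePosEdges, mem_sharedEdges]
  exact isHalfLink_cubicUnit_zero_iff hQ l

/-- **The frame's half-space observables along axis `0` are exactly Wave 0's site-RP observables**
(`Q ≥ 2`): `IsHalfObservable (cubicUnit d (2Q)) Q (x ↦ x_0) F ↔ DependsOn F (sitePosEdges ∪ sharedEdges)`. -/
theorem isHalfObservable_cubicUnit_zero_iff [NeZero Q] (hQ : 2 ≤ Q) {G α : Type*}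
    (F : GaugeConfig d (2 * Q) G → α) :
    IsHalfObservable (cubicUnit d (2 * Q)) Q (cubicAxisCoord d (2 * Q) 0) F ↔
      DependsOn F ((sitePosEdges ∪ sharedEdges : Finset (Edge d (2 * Q))) : Set (Edge d (2 * Q))) := by
  constructor
  · intro hF U V hUV
    exact hF U V fun l hl =>
      hUV l (Finset.mem_coe.2 ((isHalfLink_cubicUnit_zero_iff_mem hQ l).1 hl))
  · intro hF U V hUV
    exact hF fun l hl => hUV l ((isHalfLink_cubicUnit_zero_iff_mem hQ l).2 (Finset.mem_coe.1 hl))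

end SiteClasses

/-! ## The link family on axis `0`: half `{1 ≤ x_0 ≤ Q}` = Wave 0's positive-time half -/

section LinkClasses

variable {d Q : ℕ} [NeZero d]

/-- **A link of `(ℤ/2Q)^d` lies in the frame's half `{1 ≤ x_0 ≤ Q}` (both endpoints) iff it is one
of Wave 0's positive-time links** (`WilsonRP.IsPosEdge`; every `Q`, since `2Q / 2 = Q`). -/
theorem isMidPosLink_cubicUnit_zero_iff (l : Edge d (2 * Q)) :
    IsMidPosLink (cubicUnit d (2 * Q)) Q (cubicAxisCoord d (2 * Q) 0) l ↔ IsPosEdge l := by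
  have hdiv : 2 * Q / 2 = Q := by omega
  simp only [IsMidPosLink, InMidHalf, IsPosEdge, cubicAxisCoord_apply, add_cubicUnit_eq_shift, hdiv,
    and_assoc]

/-- The same, as membership in Wave 0's finset `WilsonRP.posEdges`. -/
theorem isMidPosLink_cubicUnit_zero_iff_mem [NeZero Q] (l : Edge d (2 * Q)) :
    IsMidPosLink (cubicUnit d (2 * Q)) Q (cubicAxisCoord d (2 * Q) 0) l ↔
      l ∈ (posEdges : Finset (Edge d (2 * Q))) := by
  rw [mem_posEdges]
  exact isMidPosLink_cubicUnit_zero_iff l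

/-- **The frame's mid-half observables along axis `0` are exactly Wave 0's positive-time
observables** (every `Q`): `IsMidObservable (cubicUnit d (2Q)) Q (x ↦ x_0) F ↔ IsPositiveTimeObservable F`. -/
theorem isMidObservable_cubicUnit_zero_iff {G α : Type*} (F : GaugeConfig d (2 * Q) G → α) :
    IsMidObservable (cubicUnit d (2 * Q)) Q (cubicAxisCoord d (2 * Q) 0) F ↔
      IsPositiveTimeObservable F := by
  have hdiv : 2 * Q / 2 = Q := by omega
  constructor
  · intro hF U V hUV
    refine hF U V fun l hl => ?_
    have hl' := (isMidPosLink_cubicUnit_zero_iff l).1 hl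
    exact hUV l hl'.1 hl'.2.1 hl'.2.2.1 hl'.2.2.2
  · intro hF U V hUV
    exact hF U V fun e h1 h2 h3 h4 =>
      hUV e ((isMidPosLink_cubicUnit_zero_iff e).2 ⟨h1, h2, h3, h4⟩)

end LinkClasses

/-! ## The two theorem families on their common domain `L = 2Q ≥ 4`, axis `0` -/

section RP

variable {d Q N : ℕ} [NeZero d] [NeZero Q]
variable {G : Type} [Group G] [TopologicalSpace G] [IsTopologicalGroup G] [CompactSpace G]
  [MeasurableSpace G] [BorelSpace G] [SecondCountableTopology G]
variable (ρ : G →* Matrix (Fin N) (Fin N) ℂ)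

/-- **Wave 0's site theorem from the frame mechanism** (`L = 2Q ≥ 4`, EVERY real `β`, compact
second countable `G : Type`, continuous `ρ`): for every bounded measurable `F` with
`DependsOn F (sitePosEdges ∪ sharedEdges)`, `0 ≤ ⟨conj F(Θ'U) · F(U)⟩_{Λ,β}` — the statement of
`wilsonExpectation_siteReflectionPositive` (which covers every even `L ≥ 2` and `G : Type*`), here a
corollary of `cubicTorus_siteRP_negReflect_anyBeta` and `isHalfObservable_cubicUnit_zero_iff`. -/
theorem wilsonExpectation_siteRP_of_frame (hQ : 2 ≤ Q) (hρ : Continuous ρ) (β : ℝ)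
    (F : GaugeConfig d (2 * Q) G → ℂ) (hF : Measurable F) (hFb : ∃ C : ℝ, ∀ U, ‖F U‖ ≤ C)
    (hFdep : DependsOn F
      ((sitePosEdges ∪ sharedEdges : Finset (Edge d (2 * Q))) : Set (Edge d (2 * Q)))) :
    0 ≤ wilsonExpectation ρ β fun U => conj (F U.negReflect) * F U := by
  unfold wilsonExpectation
  exact cubicTorus_siteRP_negReflect_anyBeta ρ hQ hρ β F hF hFb
    ((isHalfObservable_cubicUnit_zero_iff hQ F).2 hFdep)

/-- **Wave 0's link theorem from the frame mechanism** (`L = 2Q ≥ 4`, `β ≥ 0`, compact second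
countable `G : Type`, continuous `ρ`): for every bounded measurable positive-time observable `F`,
`0 ≤ ⟨conj F(ΘU) · F(U)⟩_{Λ,β}` — the statement of the named fact
`wilsonExpectation_reflectionPositive` (proved for every even `L ≥ 2` by
`wilsonExpectation_reflectionPositive_holds`), here a corollary of `cubicTorus_linkRP_timeReflect` and
`isMidObservable_cubicUnit_zero_iff`. -/
theorem wilsonExpectation_linkRP_of_frame (hQ : 2 ≤ Q) (hρ : Continuous ρ) {β : ℝ} (hβ : 0 ≤ β)
    (F : GaugeConfig d (2 * Q) G → ℂ) (hF : Measurable F) (hFb : ∃ C : ℝ, ∀ U, ‖F U‖ ≤ C)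
    (hFpos : IsPositiveTimeObservable F) :
    0 ≤ wilsonExpectation ρ β fun U => conj (F U.timeReflect) * F U := by
  unfold wilsonExpectation
  exact cubicTorus_linkRP_timeReflect ρ hQ hρ hβ F hF hFb
    ((isMidObservable_cubicUnit_zero_iff F).2 hFpos)

end RP

section Converse

variable {d Q N : ℕ} [NeZero d] [NeZero Q]
variable {G : Type*} [Group G] [TopologicalSpace G] [IsTopologicalGroup G] [CompactSpace G]
  [MeasurableSpace G] [BorelSpace G]
variable (ρ : G →* Matrix (Fin N) (Fin N) ℂ)

/-- **Conversely, the frame's axis-`0` site statement from Wave 0** (`L = 2Q ≥ 4`, every real `β`,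
compact `G : Type*` — no second countability needed on this side): for every bounded measurable
half-space observable `F` of `{0 ≤ x_0 ≤ Q}`, `0 ≤ ∫ conj F(Θ'U) · F(U) dμ_β`. -/
theorem cubicTorus_siteRP_negReflect_of_wave0 (hQ : 2 ≤ Q) (hρ : Continuous ρ) (β : ℝ)
    (F : GaugeConfig d (2 * Q) G → ℂ) (hF : Measurable F) (hFb : ∃ C : ℝ, ∀ U, ‖F U‖ ≤ C)
    (hFo : IsHalfObservable (cubicUnit d (2 * Q)) Q (cubicAxisCoord d (2 * Q) 0) F) :
    0 ≤ ∫ U, conj (F U.negReflect) * F U ∂(wilsonMeasure (d := d) (L := 2 * Q) ρ β) :=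
  wilsonExpectation_siteReflectionPositive ρ (even_two_mul Q) hρ β F hF hFb
    ((isHalfObservable_cubicUnit_zero_iff hQ F).1 hFo)

/-- **Conversely, the frame's axis-`0` link statement from Wave 0** (`L = 2Q`, every `Q ≥ 1`,
`β ≥ 0`, compact `G : Type*`): for every bounded measurable observable `F` of `{1 ≤ x_0 ≤ Q}`,
`0 ≤ ∫ conj F(ΘU) · F(U) dμ_β` — note that Wave 0 gives it also at `Q = 1` (`L = 2`), where no
site frame exists (`exists_isSiteFrame_cubicTorus_iff`). -/
theorem cubicTorus_linkRP_timeReflect_of_wave0 (hρ : Continuous ρ) {β : ℝ} (hβ : 0 ≤ β)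
    (F : GaugeConfig d (2 * Q) G → ℂ) (hF : Measurable F) (hFb : ∃ C : ℝ, ∀ U, ‖F U‖ ≤ C)
    (hFo : IsMidObservable (cubicUnit d (2 * Q)) Q (cubicAxisCoord d (2 * Q) 0) F) :
    0 ≤ ∫ U, conj (F U.timeReflect) * F U ∂(wilsonMeasure (d := d) (L := 2 * Q) ρ β) :=
  wilsonExpectation_reflectionPositive_holds ρ (even_two_mul Q) hρ hβ F hF hFb
    ((isMidObservable_cubicUnit_zero_iff F).1 hFo)

end Converse

end TiltedRP

end Summit.QuantumFields.GaugeBoot
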